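import Mathlib

/-!
# Dimock, *The renormalization group according to Balaban* II, App. B "a lattice identity": the Green identity for
the STAR FORM `⟨∂f, ∂g⟩_{*,Λ}` (half the boundary bonds) — `⟨∂f,∂g⟩_{*,Λ} = ⟨(−Δ)f, g⟩_Λ + 𝔟_Λ(∂f, g)` — and the
additivity of the star form over disjoint regions — PROVED on an arbitrary finite graph

**Citation header (reproduction of PUBLISHED work; template of the Balaban lattice Yang–Mills cell).**
J. Dimock, *The renormalization group according to Balaban. II. Large fields*, J. Math. Phys. **54** (2013) 092301
(= arXiv:1212.5562v2) [Dimock2013BalabanII]: §2.4 "a variation" (the star form, TeX L955–975; Lemma 2.4 `\label{jstar}`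
with the boundary term `𝔟_Λ`, L1000–1040) and Appendix B `\label{zzz}` "a lattice identity" (Theorem (zero), TeX
L6525–6571).  TeX line numbers refer to the arXiv source held by the cell (`inputs/files/dimock/src/1212.5562/
1212.5562.tex`, sha256[:16] 75c5792fc48eacbc).

**What the paper prints (verbatim).**  L965–970: *"Here ‖∂φ‖²_{*,Λ} contains half the bonds that cross the boundary
of Λ. Precisely it is defined for φ : 𝕋^{−k}_{M+N−k} → ℝ by ‖∂φ‖²_{*,Λ} = Σ_{⟨x,x′⟩∈Λ} L^{−3k}|∂φ(x,x′)|² + ½ Σ_{x∈Λ,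
x′∈Λ^c} L^{−3k}|∂φ(x,x′)|²"*; L971–975: *"This has the advantage that if Λ₁, Λ₂ are disjoint (but possibly with a
common boundary), then ‖∂φ‖²_{*,Λ₁∪Λ₂} = ‖∂φ‖²_{*,Λ₁} + ‖∂φ‖²_{*,Λ₂}"*; L1011–1014: *"where the boundary term is
𝔟_Λ(∂φ, 𝒵) ≡ ½ Σ_{x∈Λ, x′∈Λ^c} L^{−2k} ∂φ(x,x′)(𝒵(x) + 𝒵(x′))"*; L1029–1033: *"In appendix B it is shown that
⟨∂φ_{k,Ω}, ∂𝒵⟩_{*,Λ} = ⟨(−Δ)φ_{k,Ω}, 𝒵⟩_Λ + 𝔟_Λ(∂φ_{k,Ω}, 𝒵)"*.  App. B, L6527–6535: *"Λ be a union of cubes in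
𝕋^{−k}_{M+N−k} as in the text, and let f, g be functions on a neighborhood of Λ. We prove the following identity:
⟨∂f, ∂g⟩_{*,Λ} = ⟨(−Δ)f, g⟩_Λ + ½ Σ_{x∈Λ, x′∈Λ^c} L^{−2k} ∂f(x,x′)(g(x) + g(x′))"* (zero); proof L6537–6572:
(primo) *"⟨∂f,∂g⟩_{*,Λ} = Σ_{⟨x,x′⟩∈Λ} L^{−3k}∂f(x,x′)∂g(x,x′) + ½ Σ_{x∈Λ, x′∈Λ^c} L^{−3k}∂f(x,x′)∂g(x,x′) = … + ½
Σ_{x∈Λ, x′∈Λ^c} L^{−2k}∂f(x,x′)(g(x′) − g(x))  The first sums are over oriented bonds ⟨x,x′⟩ = ⟨x, x + L^{−k}e_μ⟩.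
The first line is the definition and the second line follows by ∂g(x,x′) = L^k(g(x′) − g(x)"* ⟦sic⟧ *"."*; then the
expansion of `⟨(−Δ)f, g⟩_Λ = ⟨∂f, ∂g_Λ⟩` with `g_Λ` the restriction (L6549–6558), (secundo) (L6559–6569: *"Here in
the second sum over we have relabeled x ↔ x′ and used ∂f(x′,x) = −∂f(x,x′)"*), and L6572: *"Now ⟨∂f,∂g⟩_{*,Λ} −
⟨(−Δ)f, g⟩_Λ gives the surface integral in (zero) as announced."*

**What is reproduced here (kernel-checked, zero `sorry`).**  The identity is pure finite bookkeeping, so it is proved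
on an ARBITRARY FINITE SIMPLE GRAPH `G` (vertices `V`, symmetric irreflexive adjacency = the bonds), for ANY vertex set
`Λ`, with the two scale factors of the print as real parameters: the volume weight `w` (print: `L^{−3k}`) and the
lattice spacing `h` (print: `L^{−k}`, so `∂f(x,x′) = (f(x′) − f(x))/h`, `(−Δf)(x) = Σ_{x′∼x}(f(x) − f(x′))/h²`, and the
boundary coefficient `L^{−2k} = w/h`).  Dimock's lattice `𝕋^{−k}_{M+N−k}` (a finite torus with nearest-neighbour
bonds) and his unions of cubes `Λ` are an instance.
* Part 1 — objects: `sgrad h f x x′` (`∂f(x,x′)`), `negLap G h f x` (`(−Δf)(x)`), the interior bond set `bondsIn G Λ`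
  (unordered bonds with both ends in `Λ`, each ONCE — the print's *"oriented bonds"*), the star form `formStar`
  (DEFINED AS PRINTED: interior bonds once + `½` of the boundary bonds), `formLap` (`⟨(−Δ)f, g⟩_Λ = Σ_{x∈Λ} w (−Δf)(x)
  g(x)`) and the boundary term `bdry` (`𝔟_Λ(∂f, g)`).
* Part 2 — BOOKKEEPING: `sum_bondsIn_eq_half` (a symmetric bond function summed once per interior bond = `½` of its sum
  over ordered adjacent pairs in `Λ`; each bond has exactly the two orientations), hence `formStar_eq_half_sum`:
  `⟨∂f,∂g⟩_{*,Λ} = ½ Σ_{x∈Λ} Σ_{x′∼x} w ∂f(x,x′)∂g(x,x′)` — every bond seen from `Λ` weighs `½` per endpoint in `Λ`.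
* Part 3 — **ADDITIVITY** (L971–975): `formStar_union` — for disjoint `Λ₁, Λ₂` (common boundary allowed),
  `⟨∂f,∂g⟩_{*,Λ₁∪Λ₂} = ⟨∂f,∂g⟩_{*,Λ₁} + ⟨∂f,∂g⟩_{*,Λ₂}`.
* Part 4 — **THEOREM (zero)**: `formStar_eq_formLap_add_bdry` — `⟨∂f,∂g⟩_{*,Λ} = ⟨(−Δ)f, g⟩_Λ + 𝔟_Λ(∂f, g)`, by the
  print's route in pointwise form: on an interior ordered pair the Laplacian summand and its relabeling `x ↔ x′` add up
  to `w ∂f∂g` (`lapTerm_add_swap`), on a boundary pair the Laplacian summand plus half the boundary summand is half of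
  `w ∂f∂g` (`lapTerm_add_half_bdryTerm`); the relabeling is `Finset.sum_comm'` over the symmetric set of ordered
  interior pairs.  No hypothesis on `h` is needed (Lean's `x/0 = 0` makes the degenerate case `h = 0` true as well).

**What is NOT claimed.**  Nothing beyond the identity and the additivity: Lemma 2.4 (jstar) itself (the cross terms of
the specific action `S*_k` with `Q_k`, `ā`, `μ̄_k`) is model bookkeeping not reproduced here; nothing of Bałaban's
papers (TEMPLATE §4.2 maps §2.4/App. B to [B11] Thm 1's multiregion geometry and [B14] §3 — grade P, "same geometry
and role").  Dimock's papers are the cell's TEMPLATE, published and refereed.  Value = the boundary-term identity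
behind `𝔟_Λ` typed once, reusable by any ledger that carries boundary terms (`TinyTermLedger`, `BoundaryTermLedger`
take their sizes as hypotheses); NOT summit progress.

Cell records: TEMPLATE.md §4.2 (row D2 §2.4 / App. B); GAPS C-tmpl27-4; unit `b2b-balaban-template` gen 27.  NEW
leaf; imports Mathlib only; modifies nothing.

VERSION v1.0.1 (docstring-only; every declaration, statement and proof byte-identical to v1 p194352): XREAD C-t4r3-60
(journal l.1359, b2b-balaban-t4-ref3-g42) D1 docfix-LOW — four TeX locators were off by 1–3 lines and are corrected
(`sgrad` L6544–6545 → L6546–6547, `bondsIn` L6544 → L6546, `sgrad_swap` L6568 → L6567, header «Now … as announced»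
L6570 → L6572; with them the header's restriction/(secundo) ranges → L6549–6558 / L6559–6569 and the proof range →
L6537–6572); no quotation or statement affected.
-/

noncomputable section

open Finset

namespace Literature.MathematicalPhysics.QuantumFieldTheory.Dimock2011to13.StarFormIdentity

variable {V : Type*}

/-! ## Part 1. Objects -/

/-- The bond derivative `∂f(x,x′) = (f(x′) − f(x))/h` (print: `∂g(x,x′) = L^k(g(x′) − g(x))`, `h = L^{−k}`).
[cite: Dimock2013BalabanII, App. B (arXiv:1212.5562v2 TeX L6546–6547)] -/
def sgrad (h : ℝ) (f : V → ℝ) (x x' : V) : ℝ := (f x' - f x) / h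

/-- `∂f(x′,x) = −∂f(x,x′)` (L6567). [cite: Dimock2013BalabanII, App. B (arXiv:1212.5562v2 TeX L6567)] -/
theorem sgrad_swap (h : ℝ) (f : V → ℝ) (x x' : V) : sgrad h f x' x = -sgrad h f x x' := by
  unfold sgrad; ring

/-- The symmetric bond function `w ∂f(x,x′)∂g(x,x′)` as a function of the unordered bond. [folklore] -/
def bondFn (w h : ℝ) (f g : V → ℝ) : Sym2 V → ℝ :=
  Sym2.lift ⟨fun x x' => w * sgrad h f x x' * sgrad h g x x', fun x x' => by
    show w * sgrad h f x x' * sgrad h g x x' = w * sgrad h f x' x * sgrad h g x' x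
    rw [sgrad_swap h f x x', sgrad_swap h g x x']; ring⟩

/-- `bondFn` on a bond. [folklore] -/
@[simp] theorem bondFn_mk (w h : ℝ) (f g : V → ℝ) (x x' : V) :
    bondFn w h f g s(x, x') = w * sgrad h f x x' * sgrad h g x x' := rfl

/-- The Laplacian summand on an ordered pair: `w (f(x) − f(x′)) g(x)/h²`. [folklore] -/
def lapTerm (w h : ℝ) (f g : V → ℝ) (x x' : V) : ℝ := w * ((f x - f x') / h ^ 2) * g x

/-- Interior pairs: the summand and its relabeling `x ↔ x′` add up to `w ∂f∂g` (the print's (secundo) step *"relabeled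
x ↔ x′ and used ∂f(x′,x) = −∂f(x,x′)"*, pointwise). [cite: Dimock2013BalabanII, App. B (arXiv:1212.5562v2 TeX L6559–6569)] -/
theorem lapTerm_add_swap (w h : ℝ) (f g : V → ℝ) (x x' : V) :
    lapTerm w h f g x x' + lapTerm w h f g x' x = w * sgrad h f x x' * sgrad h g x x' := by
  unfold lapTerm sgrad; ring

/-- Boundary pairs: the summand plus half the boundary summand is half of `w ∂f∂g` (the print's (primo) second line,
`∂g(x,x′) = (g(x′) − g(x))/h`, pointwise). [cite: Dimock2013BalabanII, App. B (arXiv:1212.5562v2 TeX L6539–6545)] -/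
theorem lapTerm_add_half_bdryTerm (w h : ℝ) (f g : V → ℝ) (x x' : V) :
    lapTerm w h f g x x' + (1 / 2) * ((w / h) * sgrad h f x x' * (g x + g x')) =
      (1 / 2) * (w * sgrad h f x x' * sgrad h g x x') := by
  unfold lapTerm sgrad; ring

/-- Splitting a sum over `s` into `s ∩ t` and `s \ t`. [folklore] -/
theorem sum_inter_add_sum_sdiff [DecidableEq V] (s t : Finset V) (F : V → ℝ) :
    ∑ x ∈ s ∩ t, F x + ∑ x ∈ s \ t, F x = ∑ x ∈ s, F x := by
  rw [← Finset.sum_union (Finset.disjoint_sdiff_inter s t).symm]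
  refine Finset.sum_congr ?_ fun _ _ => rfl
  ext x
  simp only [Finset.mem_union, Finset.mem_inter, Finset.mem_sdiff]
  tauto

variable (G : SimpleGraph V) [DecidableRel G.Adj]

/-- The ordered adjacent pairs with both ends in `Λ`. [folklore] -/
def pairsIn (Λ : Finset V) : Finset (V × V) := (Λ ×ˢ Λ).filter (fun p => G.Adj p.1 p.2)

/-- Membership in `pairsIn`. [folklore] -/
theorem mem_pairsIn {Λ : Finset V} {p : V × V} : p ∈ pairsIn G Λ ↔ p.1 ∈ Λ ∧ p.2 ∈ Λ ∧ G.Adj p.1 p.2 := by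
  unfold pairsIn; rw [Finset.mem_filter, Finset.mem_product]; tauto

variable [Fintype V]

/-- The lattice Laplacian with a minus sign: `(−Δf)(x) = Σ_{x′∼x}(f(x) − f(x′))/h²`. [folklore] -/
def negLap (h : ℝ) (f : V → ℝ) (x : V) : ℝ := ∑ x' ∈ G.neighborFinset x, (f x - f x') / h ^ 2

/-- `⟨(−Δ)f, g⟩_Λ = Σ_{x∈Λ} w (−Δf)(x) g(x)`. [cite: Dimock2013BalabanII, App. B (arXiv:1212.5562v2 TeX L6532)] -/
def formLap (w h : ℝ) (Λ : Finset V) (f g : V → ℝ) : ℝ := ∑ x ∈ Λ, w * negLap G h f x * g x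

/-- `⟨(−Δ)f, g⟩_Λ` as a double sum of `lapTerm`. [folklore] -/
theorem formLap_eq_sum (w h : ℝ) (Λ : Finset V) (f g : V → ℝ) :
    formLap G w h Λ f g = ∑ x ∈ Λ, ∑ x' ∈ G.neighborFinset x, lapTerm w h f g x x' := by
  unfold formLap negLap lapTerm
  refine Finset.sum_congr rfl fun x _ => ?_
  rw [Finset.mul_sum, Finset.sum_mul]

variable [DecidableEq V]

/-- The (unordered) bonds with both ends in `Λ`, each once — the print's sum *"over oriented bonds ⟨x,x′⟩ = ⟨x, x +
L^{−k}e_μ⟩"* inside `Λ`. [cite: Dimock2013BalabanII, App. B (arXiv:1212.5562v2 TeX L6546)] -/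
def bondsIn (Λ : Finset V) : Finset (Sym2 V) := (pairsIn G Λ).image (fun p => s(p.1, p.2))

/-- THE STAR FORM, as printed (L966–970 with `φ, φ ↦ f, g` polarised, L6539–6541): `⟨∂f,∂g⟩_{*,Λ} = Σ_{bonds ⊂ Λ} w
∂f∂g + ½ Σ_{x∈Λ, x′∈Λ^c, x′∼x} w ∂f(x,x′)∂g(x,x′)` — *"contains half the bonds that cross the boundary of Λ"*.
[cite: Dimock2013BalabanII, §2.4 (arXiv:1212.5562v2 TeX L965–970) and App. B (primo) L6539–6541] -/
def formStar (w h : ℝ) (Λ : Finset V) (f g : V → ℝ) : ℝ :=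
  ∑ e ∈ bondsIn G Λ, bondFn w h f g e +
    (1 / 2) * ∑ x ∈ Λ, ∑ x' ∈ G.neighborFinset x \ Λ, w * sgrad h f x x' * sgrad h g x x'

/-- THE BOUNDARY TERM `𝔟_Λ(∂f, g) = ½ Σ_{x∈Λ, x′∈Λ^c} (w/h) ∂f(x,x′)(g(x) + g(x′))` (print: `L^{−2k} = L^{−3k}·L^{k} =
w/h`). [cite: Dimock2013BalabanII, §2.4 Lemma 2.4 (arXiv:1212.5562v2 TeX L1011–1014); App. B (zero) L6532] -/
def bdry (w h : ℝ) (Λ : Finset V) (f g : V → ℝ) : ℝ :=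
  (1 / 2) * ∑ x ∈ Λ, ∑ x' ∈ G.neighborFinset x \ Λ, (w / h) * sgrad h f x x' * (g x + g x')

/-! ## Part 2. Bookkeeping: each bond once = half the sum over ordered pairs -/

/-- The sum over ordered adjacent pairs in `Λ` as an iterated sum over `x ∈ Λ`, `x′ ∈ N(x) ∩ Λ`. [folklore] -/
theorem sum_pairsIn_eq (Λ : Finset V) (Φ : V → V → ℝ) :
    ∑ p ∈ pairsIn G Λ, Φ p.1 p.2 = ∑ x ∈ Λ, ∑ x' ∈ G.neighborFinset x ∩ Λ, Φ x x' := by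
  unfold pairsIn
  rw [Finset.sum_filter, Finset.sum_product]
  refine Finset.sum_congr rfl fun x _ => ?_
  rw [← Finset.sum_filter]
  refine Finset.sum_congr ?_ fun _ _ => rfl
  ext x'
  simp only [Finset.mem_filter, Finset.mem_inter, SimpleGraph.mem_neighborFinset]
  tauto

/-- **EACH BOND ONCE = HALF OVER ORDERED PAIRS**: for a symmetric `Φ`, `Σ_{bonds ⊂ Λ} Φ = ½ Σ_{x∈Λ} Σ_{x′∈N(x)∩Λ}
Φ(x,x′)` — every bond `{x,x′}` has exactly the two orientations `(x,x′)`, `(x′,x)`. [folklore] -/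
theorem sum_bondsIn_eq_half (Λ : Finset V) (Φ : V → V → ℝ) (hΦ : ∀ x x', Φ x x' = Φ x' x) :
    ∑ e ∈ bondsIn G Λ, Sym2.lift ⟨Φ, hΦ⟩ e = (1 / 2) * ∑ x ∈ Λ, ∑ x' ∈ G.neighborFinset x ∩ Λ, Φ x x' := by
  rw [← sum_pairsIn_eq]
  have hfib : ∑ p ∈ pairsIn G Λ, Φ p.1 p.2 =
      ∑ e ∈ bondsIn G Λ, ∑ p ∈ (pairsIn G Λ).filter (fun p => s(p.1, p.2) = e), Φ p.1 p.2 := by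
    unfold bondsIn
    rw [Finset.sum_fiberwise_of_maps_to (fun p hp => Finset.mem_image_of_mem _ hp)]
  rw [hfib, Finset.mul_sum]
  refine Finset.sum_congr rfl fun e he => ?_
  unfold bondsIn at he
  obtain ⟨p, hp, rfl⟩ := Finset.mem_image.1 he
  obtain ⟨h1, h2, hadj⟩ := (mem_pairsIn G).1 hp
  have hne : p.1 ≠ p.2 := G.ne_of_adj hadj
  have hfiber : (pairsIn G Λ).filter (fun q => s(q.1, q.2) = s(p.1, p.2)) = {(p.1, p.2), (p.2, p.1)} := by
    ext q
    rw [Finset.mem_filter, Finset.mem_insert, Finset.mem_singleton, Sym2.eq_iff, mem_pairsIn]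
    constructor
    · rintro ⟨_, ⟨hq1, hq2⟩ | ⟨hq1, hq2⟩⟩
      · left; exact Prod.ext hq1 hq2
      · right; exact Prod.ext hq1 hq2
    · rintro (rfl | rfl)
      · exact ⟨⟨h1, h2, hadj⟩, Or.inl ⟨rfl, rfl⟩⟩
      · exact ⟨⟨h2, h1, hadj.symm⟩, Or.inr ⟨rfl, rfl⟩⟩
  rw [hfiber, Finset.sum_pair (fun h => hne (Prod.ext_iff.1 h).1)]
  simp only [Sym2.lift_mk]
  rw [hΦ p.2 p.1]; ring

/-- **THE STAR FORM AS A HALF-SUM**: `⟨∂f,∂g⟩_{*,Λ} = ½ Σ_{x∈Λ} Σ_{x′∼x} w ∂f(x,x′)∂g(x,x′)` — every bond weighs `½`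
per endpoint in `Λ` (interior bonds `½ + ½`, boundary bonds `½`). [folklore] -/
theorem formStar_eq_half_sum (w h : ℝ) (Λ : Finset V) (f g : V → ℝ) :
    formStar G w h Λ f g = (1 / 2) * ∑ x ∈ Λ, ∑ x' ∈ G.neighborFinset x, w * sgrad h f x x' * sgrad h g x x' := by
  unfold formStar bondFn
  rw [sum_bondsIn_eq_half G Λ (fun x x' => w * sgrad h f x x' * sgrad h g x x'), ← mul_add, ← Finset.sum_add_distrib]
  congr 1
  exact Finset.sum_congr rfl fun x _ => sum_inter_add_sum_sdiff _ _ _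

/-! ## Part 3. Additivity over disjoint regions (L971–975) -/

/-- **ADDITIVITY** — [Dimock2013BalabanII] §2.4, verbatim: *"if Λ₁, Λ₂ are disjoint (but possibly with a common
boundary), then ‖∂φ‖²_{*,Λ₁∪Λ₂} = ‖∂φ‖²_{*,Λ₁} + ‖∂φ‖²_{*,Λ₂}"* (polarised). PROVED.
[cite: Dimock2013BalabanII, §2.4 (arXiv:1212.5562v2 TeX L971–975)] -/
theorem formStar_union (w h : ℝ) {Λ₁ Λ₂ : Finset V} (hd : Disjoint Λ₁ Λ₂) (f g : V → ℝ) :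
    formStar G w h (Λ₁ ∪ Λ₂) f g = formStar G w h Λ₁ f g + formStar G w h Λ₂ f g := by
  rw [formStar_eq_half_sum, formStar_eq_half_sum, formStar_eq_half_sum, Finset.sum_union hd, mul_add]

/-- The quadratic case of the print, `‖∂φ‖²_{*,Λ} = ⟨∂φ,∂φ⟩_{*,Λ}`: its additivity over disjoint regions (L971–975
verbatim, un-polarised). [cite: Dimock2013BalabanII, §2.4 (arXiv:1212.5562v2 TeX L971–975)] -/
theorem normStar_union (w h : ℝ) {Λ₁ Λ₂ : Finset V} (hd : Disjoint Λ₁ Λ₂) (φ : V → ℝ) :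
    formStar G w h (Λ₁ ∪ Λ₂) φ φ = formStar G w h Λ₁ φ φ + formStar G w h Λ₂ φ φ :=
  formStar_union G w h hd φ φ

/-! ## Part 4. Theorem (zero): `⟨∂f,∂g⟩_{*,Λ} = ⟨(−Δ)f, g⟩_Λ + 𝔟_Λ(∂f, g)` -/

/-- The relabeling `x ↔ x′` over the (symmetric) set of ordered interior pairs. [folklore] -/
theorem sum_interior_swap (Λ : Finset V) (Φ : V → V → ℝ) :
    ∑ x ∈ Λ, ∑ x' ∈ G.neighborFinset x ∩ Λ, Φ x x' = ∑ x ∈ Λ, ∑ x' ∈ G.neighborFinset x ∩ Λ, Φ x' x := by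
  rw [Finset.sum_comm' (t' := Λ) (s' := fun x' => G.neighborFinset x' ∩ Λ)]
  intro x x'
  simp only [Finset.mem_inter, SimpleGraph.mem_neighborFinset]
  constructor
  · rintro ⟨hx, hadj, hx'⟩; exact ⟨⟨hadj.symm, hx⟩, hx'⟩
  · rintro ⟨⟨hadj, hx⟩, hx'⟩; exact ⟨hx, hadj.symm, hx'⟩

/-- **THEOREM (zero)** — [Dimock2013BalabanII] App. B, verbatim: *"⟨∂f, ∂g⟩_{*,Λ} = ⟨(−Δ)f, g⟩_Λ + ½ Σ_{x∈Λ, x′∈Λ^c}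
L^{−2k} ∂f(x,x′)(g(x) + g(x′))"*, i.e. `⟨∂f,∂g⟩_{*,Λ} = ⟨(−Δ)f, g⟩_Λ + 𝔟_Λ(∂f, g)` — PROVED for every finite simple
graph, every vertex set `Λ`, all `f, g`, and all scale factors `w` (= `L^{−3k}`), `h` (= `L^{−k}`).
[cite: Dimock2013BalabanII, App. B Theorem (zero) (arXiv:1212.5562v2 TeX L6530–6535, proof L6537–6572)] -/
theorem formStar_eq_formLap_add_bdry (w h : ℝ) (Λ : Finset V) (f g : V → ℝ) :
    formStar G w h Λ f g = formLap G w h Λ f g + bdry G w h Λ f g := by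
  rw [formStar_eq_half_sum, formLap_eq_sum]
  unfold bdry
  -- split the Laplacian sum into interior and boundary pairs
  have hsplit : ∑ x ∈ Λ, ∑ x' ∈ G.neighborFinset x, lapTerm w h f g x x' =
      ∑ x ∈ Λ, ∑ x' ∈ G.neighborFinset x ∩ Λ, lapTerm w h f g x x' +
        ∑ x ∈ Λ, ∑ x' ∈ G.neighborFinset x \ Λ, lapTerm w h f g x x' := by
    rw [← Finset.sum_add_distrib]
    exact Finset.sum_congr rfl fun x _ => (sum_inter_add_sum_sdiff _ _ _).symm
  have hfull : ∑ x ∈ Λ, ∑ x' ∈ G.neighborFinset x, w * sgrad h f x x' * sgrad h g x x' =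
      ∑ x ∈ Λ, ∑ x' ∈ G.neighborFinset x ∩ Λ, w * sgrad h f x x' * sgrad h g x x' +
        ∑ x ∈ Λ, ∑ x' ∈ G.neighborFinset x \ Λ, w * sgrad h f x x' * sgrad h g x x' := by
    rw [← Finset.sum_add_distrib]
    exact Finset.sum_congr rfl fun x _ => (sum_inter_add_sum_sdiff _ _ _).symm
  -- interior: symmetrise (relabel x ↔ x′)
  have hint : ∑ x ∈ Λ, ∑ x' ∈ G.neighborFinset x ∩ Λ, lapTerm w h f g x x' =
      (1 / 2) * ∑ x ∈ Λ, ∑ x' ∈ G.neighborFinset x ∩ Λ, w * sgrad h f x x' * sgrad h g x x' := by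
    have h2 : ∑ x ∈ Λ, ∑ x' ∈ G.neighborFinset x ∩ Λ, lapTerm w h f g x x' +
        ∑ x ∈ Λ, ∑ x' ∈ G.neighborFinset x ∩ Λ, lapTerm w h f g x' x =
        ∑ x ∈ Λ, ∑ x' ∈ G.neighborFinset x ∩ Λ, w * sgrad h f x x' * sgrad h g x x' := by
      rw [← Finset.sum_add_distrib]
      refine Finset.sum_congr rfl fun x _ => ?_
      rw [← Finset.sum_add_distrib]
      exact Finset.sum_congr rfl fun x' _ => lapTerm_add_swap w h f g x x'
    rw [← sum_interior_swap G Λ (lapTerm w h f g)] at h2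
    linarith
  -- boundary: pointwise
  have hbd : ∑ x ∈ Λ, ∑ x' ∈ G.neighborFinset x \ Λ, lapTerm w h f g x x' +
      (1 / 2) * ∑ x ∈ Λ, ∑ x' ∈ G.neighborFinset x \ Λ, (w / h) * sgrad h f x x' * (g x + g x') =
      (1 / 2) * ∑ x ∈ Λ, ∑ x' ∈ G.neighborFinset x \ Λ, w * sgrad h f x x' * sgrad h g x x' := by
    rw [Finset.mul_sum, Finset.mul_sum, ← Finset.sum_add_distrib]
    refine Finset.sum_congr rfl fun x _ => ?_
    rw [Finset.mul_sum, Finset.mul_sum, ← Finset.sum_add_distrib]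
    exact Finset.sum_congr rfl fun x' _ => lapTerm_add_half_bdryTerm w h f g x x'
  rw [hsplit, hfull, hint, mul_add, add_assoc, hbd]

end Literature.MathematicalPhysics.QuantumFieldTheory.Dimock2011to13.StarFormIdentity
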